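import Literature.Analysis.FluidPDE.LatticeShearWords
import HarnessLib

/-!
# K2R `RealisedQuasiStaticCellLaw`, line `floquet-bloch`, stub `stub_lowSectorDecay` (S1D): the isotropic word gain for a
# polarisation of arbitrary length

Summits-side helper file (everything proved; no definitions, no named facts; `--supports stmt-AnomalousDissipation-20446`).
`slotGain` is quadratic in the polarisation: `slotGain(q, s•p) = s²·slotGain(q, p)` (`slotGain_smul`); hence an isotropic
word (`IsotropicWordGain W c₀`, stated for unit `p`) gives `Σ_j slotGain_j(q, p) = c₀·P·‖p‖²` for every `p ⊥ q`
(`isotropicWordGain_norm_sq`) — the form in which the W-near isotropy bound `μ` is consumed (`p = z₁ζ₀ + z₂η₀`).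
-/

set_option linter.dupNamespace false

noncomputable section

namespace Summit.AnomalousDissipation.AnomalousDissipation.Theorems.SolenoidalFractalHomogenisation.RealisedQuasiStaticCellLaw

open scoped InnerProductSpace RealInnerProductSpace
open Literature.Analysis Literature.Analysis.FunctionSpaces Literature.Analysis.FunctionSpaces.Torus
open Literature.Analysis.FluidPDE Literature.Analysis.FluidPDE.LatticeShear

/-- `slotGain` is `2`-homogeneous in the polarisation. -/
theorem slotGain_smul (P : LatticePhase) (q p : EuclideanSpace ℝ (Fin 3)) (s : ℝ) :
    slotGain P q (s • p) = s ^ 2 * slotGain P q p := by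
  unfold slotGain
  simp only [norm_smul, real_inner_smul_left, Real.norm_eq_abs, mul_pow, sq_abs]
  ring

/-- **Isotropic gain for a polarisation of arbitrary length.** -/
theorem isotropicWordGain_norm_sq {k : ℕ} {W : LatticeWord k} {c₀ : ℝ} (hW : IsotropicWordGain W c₀)
    (q p : EuclideanSpace ℝ (Fin 3)) (hq : ‖q‖ = 1) (hpq : ⟪p, q⟫_ℝ = 0) :
    ∑ j, slotGain (W.phase j) q p = c₀ * W.period * ‖p‖ ^ 2 := by
  by_cases hp : p = 0
  · subst hp
    have h0 : ∀ j, slotGain (W.phase j) q 0 = 0 := fun j => by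
      have := slotGain_smul (W.phase j) q 0 0
      rw [zero_smul] at this
      simpa using this
    simp [h0]
  · have hn : 0 < ‖p‖ := norm_pos_iff.2 hp
    set u : EuclideanSpace ℝ (Fin 3) := ‖p‖⁻¹ • p with hu
    have hu1 : ‖u‖ = 1 := by rw [hu, norm_smul, norm_inv, norm_norm, inv_mul_cancel₀ hn.ne']
    have huq : ⟪u, q⟫_ℝ = 0 := by rw [hu, real_inner_smul_left, hpq, mul_zero]
    have hpu : p = ‖p‖ • u := by rw [hu, smul_smul, mul_inv_cancel₀ hn.ne', one_smul]
    have hsum := hW q u hq hu1 huq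
    calc ∑ j, slotGain (W.phase j) q p = ∑ j, ‖p‖ ^ 2 * slotGain (W.phase j) q u := by
          refine Finset.sum_congr rfl fun j _ => ?_
          conv_lhs => rw [hpu]
          exact slotGain_smul _ _ _ _
      _ = ‖p‖ ^ 2 * ∑ j, slotGain (W.phase j) q u := by rw [Finset.mul_sum]
      _ = c₀ * W.period * ‖p‖ ^ 2 := by rw [hsum]; ring

end Summit.AnomalousDissipation.AnomalousDissipation.Theorems.SolenoidalFractalHomogenisation.RealisedQuasiStaticCellLaw

end
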